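import Literature.NumberTheory.EllipticCurves.ZpExtensionEisensteinSelmerUnramifiedProofs
import HarnessLib

/-!
# The Selmer triple `(T_𝔮/p^k T_𝔮, F_𝔮, 𝓛)` of the curve at level `k` as a term of `Howard2004.SelmerTriple`
# (one definition with body + unfolding lemmas; no named fact, no instance, no notation)

Topic `NumberTheory/EllipticCurves` (D1 road of cell `pub/bsd-print-x9`; companion of
`ZpExtensionEisensteinSelmerStructure` (Howard's `F_𝔮`), `ZpExtensionEisensteinSelmerUnramifiedProofs` (Howard's `Σ(F)`
for the curve) and `GaloisCohomology/Howard2004/SelmerTriples` (lit's §D `SelmerTriple`)). Howard [arXiv 1202.6340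
§1.2, p. 6 L96–100]: «a Selmer triple `(T, F, 𝓛)`: an object `T` of `Mod_{R,K}`, a Selmer structure `F` on `T`, and a
subset `𝓛 ⊂ 𝓛₀` disjoint from `Σ(F)`»; for the height-one specialisation (§3.1, Prop. 3.1.3; proof of Thm. 3.2.10)
the triple is `(T_𝔮, F_𝔮, 𝓛)` with `𝓛 ⊇ 𝓛_s(T_𝔮)` a set of Kolyvagin primes. Level by level:

* **`WeierstrassCurve.eisensteinSelmerTriple`** — for `E/K` (`W` elliptic), `κ`, `m ≥ 1`, transitions `t`, a finite set
  `S` of finite places containing those above `p` with good reduction off `S ∪ {v ∣ p}`, ordinary data `Φ` at `v ∣ p`,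
  a level `k`, and a set `L` of finite places contained in `𝓛₀(T_𝔮/p^k)` (`Howard2004.degreeTwoPrimes`) and disjoint
  from `S`: the term of `Howard2004.SelmerTriple p (κ.eisensteinTwist (W.torsionGaloisModule ((p:ℤ)^k)) hm k)` with
  `cond := F_𝔮` at level `k` (`eisensteinSelmerStructure`), `Sigma := ∞ ∪ S` (`Finset.univ.disjSum S`), `isHoward :=`
  the kernel theorem `isHowardSelmerStructure_eisensteinSelmerStructure` (p642804), `primes := L`.
  The choice of `L` (Howard's `𝓛 ⊇ 𝓛_s(T_𝔮)`, the same at every level) is the caller's — lit's `DVRSetting.L` /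
  `SatisfiesH.primes_eq`; nothing about Kolyvagin primes is decided here.
* unfolding lemmas `eisensteinSelmerTriple_cond/_Sigma/_primes` (rfl).

No statement about Selmer groups of `E` is asserted; BSD is not proved by any of this.

References: [Howard2004HeegnerKolyvagin] §1.2 (arXiv p. 6, L96–100), Def. 1.1.10, Def. 3.1.2, Prop. 3.1.3.
-/

noncomputable section

open scoped TensorProduct ContRepresentation
open Field IsDedekindDomain
open scoped NumberField

namespace WeierstrassCurve

open Literature.NumberTheory.EllipticCurves Literature.NumberTheory.GaloisRepresentations
open Literature.NumberTheory.GaloisCohomology.Howard2004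

variable {K : Type} [Field K] [NumberField K] (W : WeierstrassCurve K) [W.IsElliptic] {p : ℕ} [Fact p.Prime]
  (κ : ZpExtension K p) {m : ℕ} (hm : 1 ≤ m)
  (t : ∀ k, (W.torsionGaloisModule ((p : ℤ) ^ (k + 1))).toContRepresentation →ⁱL
    (W.torsionGaloisModule ((p : ℤ) ^ k)).toContRepresentation)
  (S : Finset (HeightOneSpectrum (𝓞 K)))
  (Φ : ∀ v : HeightOneSpectrum (𝓞 K), ((p : ℕ) : 𝓞 K) ∈ v.asIdeal →
    ZpExtension.OrdinaryFiltration (fun k ↦ W.torsionGaloisModule ((p : ℤ) ^ k)) t v)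
  (hp : ∀ v : HeightOneSpectrum (𝓞 K), ((p : ℕ) : 𝓞 K) ∈ v.asIdeal → v ∈ S)
  (hbad : ∀ v : HeightOneSpectrum (𝓞 K), v ∉ S → ((p : ℕ) : 𝓞 K) ∉ v.asIdeal → W.HasGoodReductionAt v)
  (k : ℕ) (L : Set (HeightOneSpectrum (𝓞 K)))
  (hL : L ⊆ degreeTwoPrimes p (κ.eisensteinTwist (W.torsionGaloisModule ((p : ℤ) ^ k)) hm k))
  (hLS : ∀ v ∈ L, v ∉ S)

/-- **The Selmer triple `(T_𝔮/p^k T_𝔮, F_𝔮, 𝓛)` of the curve at level `k`** (Howard §1.2 / §3.1): Howard's Selmer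
structure `F_𝔮` (`ZpExtension.eisensteinSelmerStructure`, ordinary data `Φ` at `v ∣ p`, saturated unramified at
`v ∈ S`, unramified elsewhere), `Σ = ∞ ∪ S`, and a caller-supplied set `L` of Kolyvagin primes inside `𝓛₀(T_𝔮/p^k)`
and disjoint from `S`. [cite: Howard2004HeegnerKolyvagin, §1.2 (arXiv p. 6, L96–100), Def. 3.1.2 and Prop. 3.1.3] -/
def eisensteinSelmerTriple : SelmerTriple p (κ.eisensteinTwist (W.torsionGaloisModule ((p : ℤ) ^ k)) hm k) where
  cond := κ.eisensteinSelmerStructure (fun k ↦ W.torsionGaloisModule ((p : ℤ) ^ k)) t hm S Φ k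
  Sigma := (Finset.univ : Finset (NumberField.InfinitePlace K)).disjSum S
  isHoward := W.isHowardSelmerStructure_eisensteinSelmerStructure κ hm t S Φ hp hbad k
  primes := L
  primes_subset := hL
  disjoint v hv h := hLS v hv (Finset.inr_mem_disjSum.1 h)

/-- The local conditions of the triple are Howard's `F_𝔮` at level `k`. [cite: Howard2004HeegnerKolyvagin, Def. 3.1.2] -/
@[simp]
theorem eisensteinSelmerTriple_cond :
    (W.eisensteinSelmerTriple κ hm t S Φ hp hbad k L hL hLS).cond =
      κ.eisensteinSelmerStructure (fun k ↦ W.torsionGaloisModule ((p : ℤ) ^ k)) t hm S Φ k :=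
  rfl

/-- `Σ` of the triple is `∞ ∪ S`. [cite: Howard2004HeegnerKolyvagin, Def. 1.1.10] -/
@[simp]
theorem eisensteinSelmerTriple_Sigma :
    (W.eisensteinSelmerTriple κ hm t S Φ hp hbad k L hL hLS).Sigma =
      (Finset.univ : Finset (NumberField.InfinitePlace K)).disjSum S :=
  rfl

/-- The prime set of the triple is the given `L`. [cite: Howard2004HeegnerKolyvagin, §1.2 (arXiv p. 6, L96–100)] -/
@[simp]
theorem eisensteinSelmerTriple_primes :
    (W.eisensteinSelmerTriple κ hm t S Φ hp hbad k L hL hLS).primes = L :=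
  rfl

end WeierstrassCurve

end
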